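import Summits.QuantumFields.YangMills.Theorems.BalabanLadderIRColdDoublingRecursionSC
import Summits.QuantumFields.YangMills.Theses.DoublingDefect
import HarnessLib

/-!
# Line `selfdual-bridge` on crux `BalabanLadder.IR` (stmt-QuantumFields-19354, rung R2c) — the self-dual point, by-passed with ONE entropy input

Cell ym-ir, seat ym-ir-idea-13 g0 (lens «control» + «assume no gap» structure), LINE 2; director-ym R388 target «17754 territory».
Slot `Cruxes/IR/Lines/selfdual_bridge.lean`; card `Cruxes/IR/Lines/selfdual-bridge.md`.  Companion of LINE 1 `sharp_extension`
(45a274437bb4), whose §A–§B (the sharp extension lemma and the any-aspect defect) are COPIED in §0 below so that this workfile is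
self-contained (workfile modules are not importable on the farm).

HONEST FRAMING.  The Yang–Mills mass gap (Clay) is NOT proved by anything here, nor a lattice gap, nor `BalabanLadder.IR`, nor item
17753/17754; R4 (`BalabanUVStability4`) closes only the conditional finite-𝕋⁴ rung `BalabanLadder.UV`.  Everything outside the four
`stub_*` is PROVED and is group-blind (every compact `G`, every `β ≥ 0`).  The Yang–Mills weight of `IR_of_stubs` sits in E₁ =
`DoublingDefect.OneTorusExit` (item stmt-QuantumFields-17753 BY NAME — the symmetric-torus one-scale exit, the WEAKEST seed on the desk:
`E ⇒ E₂ ⇒ E₁`), in the NEW structural stub H½ = `HalfTimeBoundSC` (bounded half-time excess of a pure symmetric torus — «no Hagedorn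
pile-up between T = 1/L and T = 2/L»), in X and in N.

## The mechanism (what LINE 1 left open, and how it is by-passed)

LINE 1 proved that reflection-positivity bookkeeping closes the spatial extension at every aspect `time/side < 1` and is VACUOUS at the
self-dual point `time = side` (transposition identity).  Item 17753 (`OneTorusExit`, `δ_β(L) = 1 − Z(L³,2L)/Z(L³,L)² ≤ ε` at one
`L ≥ L₀` per β) lives exactly AT that point: it controls `x_L(L³)` (and colder), nothing hotter.  To feed the sharp extension one needs
ONE time `t < L` with `x_t(L³)` small and `L − t ≳ L` — i.e. one step INTO the spectrum of the cube beyond what RP gives.  The cheapest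
such input is LOG-CONVEXITY of `t ↦ x_t = Σ_{i≠0} rᵢ^t` (Cauchy–Schwarz on the spectral side, PROVED here: `exc_midpoint_sq_le`,
`x_{t}² ≤ x_{t−q} x_{t+q}`) together with a BOUND ON THE HOT END: if the half-time excess `x_{≈L/2}(L³)` is `≤ A` whenever the
symmetric torus is pure, then `x_{≈3L/4}(L³) ≤ √(2Aε)` and LINE 1's extension at aspect `3/4` (`B ≤ 2·24³`) produces a `4:1`-cold
pure box at side `4(L − ⌊L/4⌋)`: **E₁ ∧ H½ ⇒ E** (`coldExitSC_of_oneTorusExit_halfTime`, sorry-free), hence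
**IR ⇐ E₁ ∧ H½ ∧ X ∧ N** (`IR_of_stubs`).

H½ = `HalfTimeBoundSC` («assume no gap» structure, typed): for compact simple simply-connected `G` and every lattice rep `r` there
are `θ₀ > 0, A, β₁, L₁` with: for `β ≥ β₁`, `L ≥ L₁`, IF the symmetric torus is pure (`δ_β(L) ≤ θ₀`, 17753's currency) THEN
`x_{L−2⌊L/4⌋,β}(L³) ≤ A` (thermal trace excess of the cube `L³` at time `≈ L/2`, temperature `≈ 2/(La)`).  Heuristic value
`A = exp(8·(π²/45)(N²−1)·p/p_SB)` (Stefan–Boltzmann at `T ≈ 2T_c` in a box `LT ≈ 1/2`); expected TRUE FOR EVERY compact `G`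
(U(1): `x_{L/2} ≈ e^{1.75}`; its premise is scale-invariantly false there anyway) — so H½ carries NO confinement content: it is the
pure «spectral entropy» input that RP lacks at the self-dual point, and its NEGATION is a concrete pathology: a sequence of pure
symmetric tori whose free energy at temperature `2/(La)` exceeds every multiple of `T⁴` — a Hagedorn-type level pile-up between the
energy scales `1/L` and `2/L` in lattice units, excluded by nothing rigorous known to me (census B-PRICE/F-SUP are about sup-norms of
observables, not this).  The unconditional version (drop the purity premise) is FALSE-looking in the femto regime (toron/zero-mode towers make
`x_{L/2,β}(L³) → ∞` as `β → ∞` at fixed L) — hence the conditional form.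

17754 TERRITORY (honest): with k Cauchy–Schwarz steps the same input gives the symmetric-torus recursion
`δ_β(L') ≤ C_k δ_β(L)^{2 − 2^{1−k}}` (`L' ∈ [2L,4L]`), exponent `3/2` for `k = 1` — super-linear, enough for the landed iteration
after one more doubling, but NEVER the verbatim exponent `2` of item 17754: the self-dual point keeps exactly a `2^{−k}` of its
entropy.  Not typed here (no consumer); recorded on the card.

STRATEGY (README D-0145).  WHY THIS LINE: it is the minimal typed completion of the director's «17754 territory» question — WHAT must
be added to RP at `time = side`, as a Prop with a physical meaning and a crisp negation.  WHY NOVEL: no census line consumes 17753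
(`OneTorusExit`) — lines 13/15 need the 4:1 seed E, fss-handover needs E½ at 4:1, LINE 1 needs E₂ at 2:1; the log-convexity move in
TIME on the spectral side (`exc_midpoint_sq_le`) is not in the tree (`exc_two_mul_le_sq` is the `r ≤ 1` endpoint case, not
interpolation); H½ is new on the desk (nearest: idea-7's one-scale anchor `x_n ≤ e^{−a₀}` — a SMALLNESS hypothesis at 4:1; H½ is a
BOUNDEDNESS hypothesis at 2:1 conditional on 1:1 purity).  BEARS_ON: R2c stmt-QuantumFields-19354 (`IR_of_stubs` by name); item
17753 becomes a supplier of the IR ladder (dormant route `DoublingDefect` re-attached).  CHEAPEST FALSIFIER (B2, engines, kit 0):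
I13-2 — SU(2) symmetric tori `L⁴` vs `L³×⌊L/2⌋` at β_W ∈ {2.3, 2.4, 2.5}, L ∈ {8, 10, 12}: `log(1 + x_{L/2}(L³))` should sit at
`≈ 8(π²/45)·3·(p/p_SB) ≲ 5.3` wherever `δ_β(L) ≤ 1/8`; KILL H½ (as a useful stub, not logically) if it grows with L at fixed purity.
INSTRUMENT: the pair (`δ_β(L)` symmetric, `x_{L−2⌊L/4⌋}(L³)`), both plain partition-function ratios.

References: Lüscher 1977 (transfer matrix); Osterwalder–Seiler 1978 §§2–3; Privman–Fisher 1983 (aspect-ratio FSS); Hardy–Littlewood–Pólya,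
*Inequalities* §2.9–2.10 (Lyapunov/log-convexity of power sums = `exc_midpoint_sq_le`); Boyd et al., Nucl. Phys. B469 (1996) 419 and
Borsányi et al. JHEP 07 (2012) 056 (lattice `p/T⁴ < p_SB/T⁴` for SU(3) — the heuristic behind `A`); Hagedorn 1965 (the negation's shape).
-/

noncomputable section

open MeasureTheory Filter
open scoped BigOperators Topology
open Literature.MathematicalPhysics.QuantumFieldTheory Literature.MathematicalPhysics.QuantumLattice
open Summit.QuantumFields.YangMills.Cruxes.IR.AspectBootstrap
open Summit.QuantumFields.YangMills.Cruxes.IR.ColdPurityBridge (coldDefect ColdExitSC ColdDoublingRecursionSC IR_of_bridge)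
open Summit.QuantumFields.YangMills.Cruxes.IR.ColdPressurePincer (AFToColdPressure IRnsc)
open Summit.QuantumFields.YangMills.Theses.DoublingDefect (OneTorusExit)

namespace Summit.QuantumFields.YangMills.Cruxes.IR.SelfDualBridge

/-! ## §0 Copied from LINE 1 (`Lines/sharp_extension.lean` §A–§B, sorry-free): the sharp extension lemma and the any-aspect defect -/


section Family

variable {Z : ℕ → ℕ → ℕ → ℕ → ℝ}

/-- **Casimir slope ≤ transposed excitation** (the controlling quantity; no third box, no tower): for `2 ≤ n, n'`,
`n ((n'/n) φ(n,b) − φ(n',b)) ≤ Y_n(n',b)` — from `n' φ(n,b) ≤ log Z(n,b,n') = log Z(n',b,n)` (Sym `(0 3)`). -/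
theorem slope_le_Yfun (hS : IsAxisSymmetric Z) (hT : IsTracePositive Z) {b₁ b₂ n n' : ℕ}
    (hb₁ : 2 ≤ b₁) (hb₂ : 2 ≤ b₂) (hn : 2 ≤ n) (hn' : 2 ≤ n') :
    (n : ℝ) * (((n' : ℝ) / n) * phi (Z n b₁ b₂) - phi (Z n' b₁ b₂)) ≤ Yfun (Z n' b₁ b₂) n := by
  obtain ⟨kn, rfl⟩ : ∃ kn, n = kn + 2 := ⟨n - 2, by omega⟩
  obtain ⟨kn', rfl⟩ : ∃ kn', n' = kn' + 2 := ⟨n' - 2, by omega⟩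
  have hdn : HasSpectralDatum (Z (kn + 2) b₁ b₂) := hT _ _ _ (by omega) hb₁ hb₂
  have A1 := mul_phi_le_log hdn kn'
  have A3 : Z (kn + 2) b₁ b₂ (kn' + 2) = Z (kn' + 2) b₁ b₂ (kn + 2) := (hS _ _ _ _).1
  rw [A3] at A1
  have hnpos : (0 : ℝ) < ((kn + 2 : ℕ) : ℝ) := by positivity
  have e : ((kn + 2 : ℕ) : ℝ) * (((kn' + 2 : ℕ) : ℝ) / ((kn + 2 : ℕ) : ℝ) * phi (Z (kn + 2) b₁ b₂)) =
      ((kn' + 2 : ℕ) : ℝ) * phi (Z (kn + 2) b₁ b₂) := by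
    field_simp
  unfold Yfun
  rw [mul_sub, e]
  push_cast at A1 ⊢
  linarith

/-- **SHARP EXTENSION LEMMA** (sorry-free): for `2 ≤ c < n ≤ n'` and any cross-section `(b₁,b₂)`,
`Y_c(n',b₁,b₂) ≤ (n'/(n − c)) · Y_c(n,b₁,b₂)` — the fixed-time spatial extension closes for EVERY aspect `c/n < 1`
(no tower, no volume bounds, no `L ≥ 8`). -/
theorem extension_sharp (hS : IsAxisSymmetric Z) (hT : IsTracePositive Z) {b₁ b₂ c n n' : ℕ}
    (hb₁ : 2 ≤ b₁) (hb₂ : 2 ≤ b₂) (hc : 2 ≤ c) (hcn : c < n) (hnn' : n ≤ n') :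
    Yfun (Z n' b₁ b₂) c ≤ (n' : ℝ) / ((n : ℝ) - c) * Yfun (Z n b₁ b₂) c := by
  have hn : 2 ≤ n := by omega
  have hn' : 2 ≤ n' := by omega
  have E := extension_step hS hT hb₁ hb₂ hc hn hnn'
  have S := slope_le_Yfun hS hT hb₁ hb₂ hn hn'
  obtain ⟨kc, rfl⟩ : ∃ kc, c = kc + 2 := ⟨c - 2, by omega⟩
  obtain ⟨kn, rfl⟩ : ∃ kn, n = kn + 2 := ⟨n - 2, by omega⟩
  obtain ⟨kn', rfl⟩ : ∃ kn', n' = kn' + 2 := ⟨n' - 2, by omega⟩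
  have hdn' : HasSpectralDatum (Z (kn' + 2) b₁ b₂) := hT _ _ _ hn' hb₁ hb₂
  have M := Yfun_antitone hdn' (show kc ≤ kn by omega)
  set W := Yfun (Z (kn' + 2) b₁ b₂) (kc + 2) with hW
  set V := Yfun (Z (kn + 2) b₁ b₂) (kc + 2) with hV
  set s := ((kn' + 2 : ℕ) : ℝ) / ((kn + 2 : ℕ) : ℝ) * phi (Z (kn + 2) b₁ b₂) - phi (Z (kn' + 2) b₁ b₂) with hs
  have hnpos : (0 : ℝ) < ((kn + 2 : ℕ) : ℝ) := by positivity
  have hcpos : (0 : ℝ) ≤ ((kc + 2 : ℕ) : ℝ) := by positivity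
  have hnc : (0 : ℝ) < ((kn + 2 : ℕ) : ℝ) - ((kc + 2 : ℕ) : ℝ) := by
    have : ((kc + 2 : ℕ) : ℝ) < ((kn + 2 : ℕ) : ℝ) := by exact_mod_cast hcn
    linarith
  have S' : ((kn + 2 : ℕ) : ℝ) * s ≤ W := le_trans S M
  have E' : ((kn + 2 : ℕ) : ℝ) * W ≤ ((kn' + 2 : ℕ) : ℝ) * V + ((kc + 2 : ℕ) : ℝ) * W := by
    have h1 : ((kn + 2 : ℕ) : ℝ) * W ≤
        ((kn + 2 : ℕ) : ℝ) * (((kn' + 2 : ℕ) : ℝ) / ((kn + 2 : ℕ) : ℝ) * V + ((kc + 2 : ℕ) : ℝ) * s) :=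
      mul_le_mul_of_nonneg_left E hnpos.le
    have h2 : ((kn + 2 : ℕ) : ℝ) * (((kn' + 2 : ℕ) : ℝ) / ((kn + 2 : ℕ) : ℝ) * V + ((kc + 2 : ℕ) : ℝ) * s) =
        ((kn' + 2 : ℕ) : ℝ) * V + ((kc + 2 : ℕ) : ℝ) * (((kn + 2 : ℕ) : ℝ) * s) := by
      field_simp
    have h3 : ((kc + 2 : ℕ) : ℝ) * (((kn + 2 : ℕ) : ℝ) * s) ≤ ((kc + 2 : ℕ) : ℝ) * W :=
      mul_le_mul_of_nonneg_left S' hcpos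
    linarith
  have E'' : (((kn + 2 : ℕ) : ℝ) - ((kc + 2 : ℕ) : ℝ)) * W ≤ ((kn' + 2 : ℕ) : ℝ) * V := by linarith
  rw [div_mul_eq_mul_div, le_div_iff₀ (by push_cast at hnc ⊢; linarith)]
  push_cast at E'' ⊢
  linarith

/-- The cube version: `Y_c(L',L',L') ≤ (L'/(L−c))³ · Y_c(L,L,L)` for `2 ≤ c < L ≤ L'` (three sharp extensions, the
extended side moved to slot 0 by Sym `(0 1)`, `(0 2)`). -/
theorem cube_extension_sharp (hS : IsAxisSymmetric Z) (hT : IsTracePositive Z) {c L L' : ℕ}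
    (hc : 2 ≤ c) (hcL : c < L) (hLL' : L ≤ L') :
    Yfun (Z L' L' L') c ≤ ((L' : ℝ) / ((L : ℝ) - c)) ^ 3 * Yfun (Z L L L) c := by
  have hL : 2 ≤ L := by omega
  have hL' : 2 ≤ L' := by omega
  have e1 := extension_sharp hS hT hL hL hc hcL hLL'
  have e2 := extension_sharp hS hT hL' hL hc hcL hLL'
  have e3 := extension_sharp hS hT hL' hL' hc hcL hLL'
  have s1 : Z L' L L = Z L L' L := funext fun τ => (hS L' L L τ).2.1
  have s2 : Z L' L' L = Z L L' L' := funext fun τ => (hS L' L' L τ).2.2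
  rw [s1] at e1
  rw [s2] at e2
  obtain ⟨kc, rfl⟩ : ∃ kc, c = kc + 2 := ⟨c - 2, by omega⟩
  have hq : 0 ≤ (L' : ℝ) / ((L : ℝ) - ((kc + 2 : ℕ) : ℝ)) := by
    apply div_nonneg (by positivity)
    have : (((kc + 2 : ℕ) : ℝ)) < (L : ℝ) := by exact_mod_cast hcL
    linarith
  set q : ℝ := (L' : ℝ) / ((L : ℝ) - ((kc + 2 : ℕ) : ℝ))
  calc Yfun (Z L' L' L') (kc + 2) ≤ q * Yfun (Z L L' L') (kc + 2) := e3
    _ ≤ q * (q * Yfun (Z L L' L) (kc + 2)) := mul_le_mul_of_nonneg_left e2 hq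
    _ ≤ q * (q * (q * Yfun (Z L L L) (kc + 2))) :=
        mul_le_mul_of_nonneg_left (mul_le_mul_of_nonneg_left e1 hq) hq
    _ = q ^ 3 * Yfun (Z L L L) (kc + 2) := by ring


/-- The period-doubling defect of the cube `L³` read at time `t`: `δ^{(t)}(L) = 1 − Z(L,L,L,2t)/Z(L,L,L,t)²`.
`boxDefect Z L` (aspect `4:1`) is `aspectDefect Z L (L/4)` and the model's `coldDefect`/`twoOneDefect` are its instances. -/
def aspectDefect (Z : ℕ → ℕ → ℕ → ℕ → ℝ) (L t : ℕ) : ℝ :=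
  1 - Z L L L (2 * t) / Z L L L t ^ 2

theorem boxDefect_eq_aspectDefect (Z : ℕ → ℕ → ℕ → ℕ → ℝ) (L : ℕ) :
    boxDefect Z L = aspectDefect Z L (L / 4) := rfl

/-- `0 ≤ δ^{(t)} ≤ 1`, `δ^{(t)} ≤ 2 x_t`, and `δ^{(t)} ≤ 1/2 ⇒ x_t ≤ 2 δ^{(t)}` (`defect_facts`). -/
theorem aspectDefect_facts (hT : IsTracePositive Z) {L t : ℕ} (hL : 2 ≤ L) (ht : 2 ≤ t) :
    0 ≤ aspectDefect Z L t ∧ aspectDefect Z L t ≤ 1 ∧ aspectDefect Z L t ≤ 2 * exc (Z L L L) t ∧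
      (aspectDefect Z L t ≤ 1 / 2 → exc (Z L L L) t ≤ 2 * aspectDefect Z L t) := by
  obtain ⟨k, rfl⟩ : ∃ k, t = k + 2 := ⟨t - 2, by omega⟩
  have hz : HasSpectralDatum (Z L L L) := hT L L L hL hL hL
  obtain ⟨h0, h1, h2, h3⟩ := defect_facts hz k
  unfold aspectDefect
  exact ⟨h0, h1, h2, fun h => h3 _ h le_rfl⟩

/-- **Fixed-time extension of the defect at ANY aspect `t < L`**: for `2 ≤ t < L ≤ L'`,
`δ^{(t)}(L') ≤ 2 (B δ) e^{B δ}` with `δ = δ^{(t)}(L)`, `B = 2 (L'/(L−t))³` (three sharp extensions + `e^y − 1 ≤ y e^y`). -/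
theorem aspectDefect_extension (hS : IsAxisSymmetric Z) (hT : IsTracePositive Z) {t L L' : ℕ}
    (ht : 2 ≤ t) (htL : t < L) (hLL' : L ≤ L') :
    aspectDefect Z L' t ≤
      2 * ((2 * ((L' : ℝ) / ((L : ℝ) - t)) ^ 3) * aspectDefect Z L t) *
        Real.exp ((2 * ((L' : ℝ) / ((L : ℝ) - t)) ^ 3) * aspectDefect Z L t) := by
  have hL : 2 ≤ L := by omega
  have hL' : 2 ≤ L' := by omega
  obtain ⟨hδ0, -, -, hxδ⟩ := aspectDefect_facts hT hL ht
  obtain ⟨-, hδ'1, hδ'x, -⟩ := aspectDefect_facts hT hL' ht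
  have hY' := cube_extension_sharp hS hT ht htL hLL'
  obtain ⟨k, rfl⟩ : ∃ k, t = k + 2 := ⟨t - 2, by omega⟩
  have hz : HasSpectralDatum (Z L L L) := hT L L L hL hL hL
  have hz' : HasSpectralDatum (Z L' L' L') := hT L' L' L' hL' hL' hL'
  set q : ℝ := (L' : ℝ) / ((L : ℝ) - ((k + 2 : ℕ) : ℝ)) with hq
  set B : ℝ := 2 * q ^ 3 with hB
  set δ : ℝ := aspectDefect Z L (k + 2) with hδ
  set δ' : ℝ := aspectDefect Z L' (k + 2) with hδ'
  have htL' : ((k + 2 : ℕ) : ℝ) < (L : ℝ) := by exact_mod_cast htL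
  have hden : 0 < (L : ℝ) - ((k + 2 : ℕ) : ℝ) := by linarith
  have hq1 : 1 ≤ q := by
    rw [hq, le_div_iff₀ hden]
    have : (L : ℝ) ≤ L' := by exact_mod_cast hLL'
    have : (0 : ℝ) ≤ ((k + 2 : ℕ) : ℝ) := by positivity
    linarith
  have hq0 : 0 ≤ q := le_trans zero_le_one hq1
  have hq3 : 1 ≤ q ^ 3 := one_le_pow₀ hq1
  have hB2 : 2 ≤ B := by rw [hB]; linarith
  by_cases hhalf : 1 / 2 < δ
  · have h1 : 1 ≤ B * δ := by nlinarith
    have h2 : 1 ≤ Real.exp (B * δ) := Real.one_le_exp (by positivity)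
    calc δ' ≤ 1 := hδ'1
      _ ≤ 2 * (B * δ) * Real.exp (B * δ) := by nlinarith
  push Not at hhalf
  have hx : exc (Z L L L) (k + 2) ≤ 2 * δ := hxδ hhalf
  have hy : Yfun (Z L L L) (k + 2) ≤ 2 * δ := (Yfun_le_exc hz k).trans hx
  have hY'' : Yfun (Z L' L' L') (k + 2) ≤ B * δ := by
    have := mul_le_mul_of_nonneg_left hy (le_trans zero_le_one hq3)
    calc Yfun (Z L' L' L') (k + 2) ≤ q ^ 3 * Yfun (Z L L L) (k + 2) := hY'
      _ ≤ q ^ 3 * (2 * δ) := this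
      _ = B * δ := by rw [hB]; ring
  have hx' : exc (Z L' L' L') (k + 2) ≤ Real.exp (B * δ) - 1 := by
    rw [exc_eq_exp_Yfun hz' k]
    linarith [Real.exp_le_exp.2 hY'']
  have hu : Real.exp (B * δ) - 1 ≤ B * δ * Real.exp (B * δ) := Literature.Analysis.ODE.exp_sub_one_le_mul_exp _
  calc δ' ≤ 2 * exc (Z L' L' L') (k + 2) := hδ'x
    _ ≤ 2 * (Real.exp (B * δ) - 1) := by linarith
    _ ≤ 2 * (B * δ) * Real.exp (B * δ) := by linarith

/-! ## §1 Log-convexity of the thermal excess in time (Cauchy–Schwarz on the spectral side; sorry-free) -/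

/-- **`x_{m+k+2}² ≤ x_{m+2} · x_{m+2k+2}`** — the thermal trace excess `x_t = Σ_{i≠i₀} rᵢ^t` of a spectral datum is log-convex in
the time: Cauchy–Schwarz with `fᵢ = rᵢ^{(m+2)/2}`, `gᵢ = rᵢ^{(m+2k+2)/2}` (Hardy–Littlewood–Pólya §2.9).  The tree's `exc_two_mul_le_sq`
(`x_{2t} ≤ x_t²`) is the different, `rᵢ ≤ 1`, endpoint statement. -/
theorem exc_midpoint_sq_le {z : ℕ → ℝ} (h : HasSpectralDatum z) (m k : ℕ) :
    exc z (m + k + 2) ^ 2 ≤ exc z (m + 2) * exc z (m + 2 * k + 2) := by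
  classical
  obtain ⟨ι, _, r, i₀, hr, -, -, -, hsum⟩ := exists_ratios h
  set f : ι → ℝ := Function.update (fun i => Real.sqrt (r i) ^ (m + 2)) i₀ 0 with hf
  set g : ι → ℝ := Function.update (fun i => Real.sqrt (r i) ^ (m + 2 * k + 2)) i₀ 0 with hg
  have hf0 : ∀ i, 0 ≤ f i := by
    intro i
    by_cases hi : i = i₀
    · simp [hf, hi]
    · simp only [hf, Function.update_of_ne hi]; positivity
  have hg0 : ∀ i, 0 ≤ g i := by
    intro i
    by_cases hi : i = i₀
    · simp [hg, hi]
    · simp only [hg, Function.update_of_ne hi]; positivity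
  have hsq : ∀ i, Real.sqrt (r i) ^ 2 = r i := fun i => Real.sq_sqrt (hr i).1
  have hf2 : (fun i => f i ^ (2 : ℝ)) = Function.update (fun i => r i ^ (m + 2)) i₀ 0 := by
    funext i
    rw [Real.rpow_two]
    by_cases hi : i = i₀
    · simp [hf, hi]
    · simp only [hf, Function.update_of_ne hi]
      rw [← pow_mul, mul_comm, pow_mul, hsq]
  have hg2 : (fun i => g i ^ (2 : ℝ)) = Function.update (fun i => r i ^ (m + 2 * k + 2)) i₀ 0 := by
    funext i
    rw [Real.rpow_two]
    by_cases hi : i = i₀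
    · simp [hg, hi]
    · simp only [hg, Function.update_of_ne hi]
      rw [← pow_mul, mul_comm, pow_mul, hsq]
  have hfg : (fun i => f i * g i) = Function.update (fun i => r i ^ (m + k + 2)) i₀ 0 := by
    funext i
    by_cases hi : i = i₀
    · simp [hf, hg, hi]
    · simp only [hf, hg, Function.update_of_ne hi]
      rw [← pow_add, show m + 2 + (m + 2 * k + 2) = 2 * (m + k + 2) by ring, pow_mul, hsq]
  set A : ℝ := Real.sqrt (exc z (m + 2)) with hA
  set B : ℝ := Real.sqrt (exc z (m + 2 * k + 2)) with hB
  have hxm : 0 ≤ exc z (m + 2) := exc_nonneg h m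
  have hxM : 0 ≤ exc z (m + 2 * k + 2) := exc_nonneg h (m + 2 * k)
  have hA2 : A ^ (2 : ℝ) = exc z (m + 2) := by rw [Real.rpow_two, hA, Real.sq_sqrt hxm]
  have hB2 : B ^ (2 : ℝ) = exc z (m + 2 * k + 2) := by rw [Real.rpow_two, hB, Real.sq_sqrt hxM]
  have hf_sum : HasSum (fun i => f i ^ (2 : ℝ)) (A ^ (2 : ℝ)) := by rw [hf2, hA2]; exact hsum m
  have hg_sum : HasSum (fun i => g i ^ (2 : ℝ)) (B ^ (2 : ℝ)) := by rw [hg2, hB2]; exact hsum (m + 2 * k)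
  obtain ⟨C, hC0, hCle, hC⟩ := Real.inner_le_Lp_mul_Lq_hasSum_of_nonneg Real.HolderConjugate.two_two
    (Real.sqrt_nonneg _) (Real.sqrt_nonneg _) hf0 hg0 hf_sum hg_sum
  have hmid : HasSum (fun i => f i * g i) (exc z (m + k + 2)) := by rw [hfg]; exact hsum (m + k)
  have hCeq : C = exc z (m + k + 2) := hC.unique hmid
  have hAB : 0 ≤ A * B := mul_nonneg (Real.sqrt_nonneg _) (Real.sqrt_nonneg _)
  calc exc z (m + k + 2) ^ 2 = C ^ 2 := by rw [hCeq]
    _ ≤ (A * B) ^ 2 := pow_le_pow_left₀ hC0 hCle 2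
    _ = A ^ 2 * B ^ 2 := by ring
    _ = exc z (m + 2) * exc z (m + 2 * k + 2) := by rw [hA, hB, Real.sq_sqrt hxm, Real.sq_sqrt hxM]

/-! ## §2 From a pure SYMMETRIC torus plus a bounded half-time excess to a pure cold box (abstract; sorry-free) -/

/-- The bootstrap constant at aspect `3/4`: `2·(4t/q)³ ≤ 2·24³` for `t = L − q`, `q = ⌊L/4⌋`. -/
def threeQuarterConst : ℝ := 27648

/-- **E₁ ∧ H½ ⇒ cold purity, one box** (sorry-free): if the symmetric torus `L⁴` is pure, `δ^{(L)}(L) ≤ ε ≤ 1/2`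
(17753's currency), and the half-time excess is bounded, `x_{L−2q}(L³) ≤ A` (`q = ⌊L/4⌋`), then with `t = L − q` the `4:1`-cold box of
side `4t` is pure: `δ^{(t)}(4t) ≤ 2 (B₀ u) e^{B₀ u}`, `u = 2√(2Aε)`, `B₀ = threeQuarterConst` — Cauchy–Schwarz (`x_t² ≤ x_{L−2q} x_L`)
then the sharp extension at aspect `t/L ≈ 3/4`. -/
theorem cold_of_symmetric_halfTime (hS : IsAxisSymmetric Z) (hT : IsTracePositive Z) {L : ℕ} (hL : 8 ≤ L) {A ε : ℝ}
    (hA : exc (Z L L L) (L - 2 * (L / 4)) ≤ A) (hε : aspectDefect Z L L ≤ ε) (hεh : ε ≤ 1 / 2) :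
    aspectDefect Z (4 * (L - L / 4)) (L - L / 4) ≤
      2 * (threeQuarterConst * (2 * Real.sqrt (2 * A * ε))) * Real.exp (threeQuarterConst * (2 * Real.sqrt (2 * A * ε))) := by
  have hL2 : 2 ≤ L := by omega
  have hz : HasSpectralDatum (Z L L L) := hT L L L hL2 hL2 hL2
  set q := L / 4 with hq
  set t := L - q with ht
  have hq2 : 2 ≤ q := by omega
  have hqL : 4 * q ≤ L := by omega
  have hLq : L ≤ 4 * q + 3 := by omega
  have ht2 : 2 ≤ t := by omega
  have htL : t < L := by omega
  have hL4t : L ≤ 4 * t := by omega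
  -- indices in `m + 2` form: `L − 2q = m + 2`, `t = m + q + 2`, `L = m + 2q + 2`
  obtain ⟨m, hm1, hm2, hm3⟩ : ∃ m, L - 2 * q = m + 2 ∧ t = m + q + 2 ∧ L = m + 2 * q + 2 :=
    ⟨L - 2 * q - 2, by omega, by omega, by omega⟩
  -- purity of the symmetric torus: `x_L ≤ 2 δ ≤ 2 ε`
  obtain ⟨-, -, -, hxδ⟩ := aspectDefect_facts hT (L := L) (t := L) hL2 hL2
  have hxL : exc (Z L L L) L ≤ 2 * ε := by
    have := hxδ (hε.trans hεh)
    linarith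
  have hxL0 : 0 ≤ exc (Z L L L) L := by
    have e := exc_nonneg hz (m + 2 * q); rwa [← hm3] at e
  have hxh0 : 0 ≤ exc (Z L L L) (L - 2 * q) := by
    have e := exc_nonneg hz m; rwa [← hm1] at e
  have hA0 : 0 ≤ A := hxh0.trans hA
  have hε0 : 0 ≤ ε := by
    have := (aspectDefect_facts hT (L := L) (t := L) hL2 hL2).1
    linarith
  -- Cauchy–Schwarz: `x_t² ≤ x_{L−2q} · x_L ≤ A · 2ε`
  have hCS : exc (Z L L L) t ^ 2 ≤ exc (Z L L L) (L - 2 * q) * exc (Z L L L) L := by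
    have e := exc_midpoint_sq_le hz m q
    rw [← hm3, ← hm2, ← hm1] at e
    exact e
  have hxt0 : 0 ≤ exc (Z L L L) t := by
    have e := exc_nonneg hz (m + q); rwa [← hm2] at e
  have hxt2 : exc (Z L L L) t ^ 2 ≤ 2 * A * ε := by
    calc exc (Z L L L) t ^ 2 ≤ exc (Z L L L) (L - 2 * q) * exc (Z L L L) L := hCS
      _ ≤ A * (2 * ε) := mul_le_mul hA hxL hxL0 hA0
      _ = 2 * A * ε := by ring
  have hxt : exc (Z L L L) t ≤ Real.sqrt (2 * A * ε) := by
    calc exc (Z L L L) t = Real.sqrt (exc (Z L L L) t ^ 2) := (Real.sqrt_sq hxt0).symm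
      _ ≤ Real.sqrt (2 * A * ε) := Real.sqrt_le_sqrt hxt2
  -- the defect at time t of the cube L³ is ≤ 2 x_t
  obtain ⟨hδt0, -, hδtx, -⟩ := aspectDefect_facts hT (L := L) (t := t) hL2 ht2
  set u : ℝ := 2 * Real.sqrt (2 * A * ε) with hu
  have hδtu : aspectDefect Z L t ≤ u := by rw [hu]; linarith
  -- sharp extension at aspect t/L to side 4t
  have key := aspectDefect_extension hS hT ht2 htL hL4t
  -- the constant: `4t/(L − t) = 4t/q ≤ 24`
  have hcast : ((L : ℝ) - ((t : ℕ) : ℝ)) = (q : ℝ) := by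
    rw [ht, Nat.cast_sub (by omega : q ≤ L)]; ring
  have hqpos : (0 : ℝ) < q := by exact_mod_cast (show 0 < q by omega)
  have hratio : (((4 * t : ℕ)) : ℝ) / ((L : ℝ) - ((t : ℕ) : ℝ)) ≤ 24 := by
    rw [hcast, div_le_iff₀ hqpos]
    have : ((t : ℕ) : ℝ) ≤ 6 * (q : ℝ) := by exact_mod_cast (show t ≤ 6 * q by omega)
    push_cast; linarith
  have hratio0 : 0 ≤ (((4 * t : ℕ)) : ℝ) / ((L : ℝ) - ((t : ℕ) : ℝ)) := by rw [hcast]; positivity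
  have hB : 2 * ((((4 * t : ℕ)) : ℝ) / ((L : ℝ) - ((t : ℕ) : ℝ))) ^ 3 ≤ threeQuarterConst := by
    have : ((((4 * t : ℕ)) : ℝ) / ((L : ℝ) - ((t : ℕ) : ℝ))) ^ 3 ≤ 24 ^ 3 := pow_le_pow_left₀ hratio0 hratio 3
    unfold threeQuarterConst; linarith
  set B := 2 * ((((4 * t : ℕ)) : ℝ) / ((L : ℝ) - ((t : ℕ) : ℝ))) ^ 3 with hBdef
  have hB0 : 0 ≤ B := by positivity
  have hTQ0 : (0 : ℝ) ≤ threeQuarterConst := by unfold threeQuarterConst; norm_num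
  calc aspectDefect Z (4 * t) t ≤ 2 * (B * aspectDefect Z L t) * Real.exp (B * aspectDefect Z L t) := key
    _ ≤ 2 * (threeQuarterConst * u) * Real.exp (threeQuarterConst * u) := by gcongr

/-- E ⇒ E₁ at one box (the trivial direction, for the record): the symmetric defect is at most `4×` the cold defect,
`δ^{(L)}(L) ≤ 2 x_L ≤ 2 x_{⌊L/4⌋} ≤ 4 δᶜ(L)` (when `δᶜ(L) ≤ 1/2`; trivially otherwise). -/
theorem symDefect_le_four_mul_boxDefect (hT : IsTracePositive Z) {L : ℕ} (hL : 8 ≤ L) :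
    aspectDefect Z L L ≤ 4 * boxDefect Z L := by
  have hL2 : 2 ≤ L := by omega
  have hz : HasSpectralDatum (Z L L L) := hT L L L hL2 hL2 hL2
  rw [boxDefect_eq_aspectDefect]
  obtain ⟨hc0, -, -, hcx⟩ := aspectDefect_facts hT (L := L) (t := L / 4) hL2 (by omega)
  obtain ⟨-, hs1, hsx, -⟩ := aspectDefect_facts hT (L := L) (t := L) hL2 hL2
  by_cases hhalf : 1 / 2 < aspectDefect Z L (L / 4)
  · linarith
  push Not at hhalf
  obtain ⟨k, hk⟩ : ∃ k, L / 4 = k + 2 := ⟨L / 4 - 2, by omega⟩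
  obtain ⟨k', hk'⟩ : ∃ k', L = k' + 2 := ⟨L - 2, by omega⟩
  have hanti : exc (Z L L L) L ≤ exc (Z L L L) (L / 4) := by
    have e := exc_antitone hz (show k ≤ k' by omega)
    rw [← hk, ← hk'] at e
    exact e
  linarith [hcx hhalf]

end Family

/-! ## §3 The model: Props and the seam E₁ ∧ H½ ⇒ E (sorry-free) -/

section Model

variable {G : Type} [Group G] [TopologicalSpace G] [IsTopologicalGroup G] [CompactSpace G]
  [MeasurableSpace G] [BorelSpace G]

/-- The symmetric-torus period-doubling defect `δ_β(L) = 1 − Z_β(L,L,L,2L)/Z_β(L,L,L,L)²` — VERBATIM the `δ` of items 17753/17754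
(their inline `Z β a t` is `wilsonFinTorusPartition r.ρ β a a a t` by `rfl`). -/
def symDefect {N : ℕ} (ρ : G →* Matrix (Fin N) (Fin N) ℂ) (β : ℝ) (L : ℕ) : ℝ :=
  1 - wilsonFinTorusPartition ρ β L L L (2 * L) / wilsonFinTorusPartition ρ β L L L L ^ 2

theorem symDefect_eq {N : ℕ} (ρ : G →* Matrix (Fin N) (Fin N) ℂ) (β : ℝ) (L : ℕ) :
    symDefect ρ β L = aspectDefect (wilsonFinTorusPartition ρ β) L L := rfl

theorem coldDefect_eq_aspectDefect {N : ℕ} (ρ : G →* Matrix (Fin N) (Fin N) ℂ) (β : ℝ) (L : ℕ) :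
    coldDefect ρ β L = aspectDefect (wilsonFinTorusPartition ρ β) L (L / 4) := rfl

/-- The **half-time excess** of the cube `L³`: `x_{L−2⌊L/4⌋,β}(L³)` (time `≈ L/2`, temperature `≈ 2/(La)`), the thermal trace excess
`exc` of the landed one-box bookkeeping applied to the Wilson family. -/
def halfTimeExcess {N : ℕ} (ρ : G →* Matrix (Fin N) (Fin N) ℂ) (β : ℝ) (L : ℕ) : ℝ :=
  exc (wilsonFinTorusPartition ρ β L L L) (L - 2 * (L / 4))

/-- E ⇒ E₁ pointwise in the model: `δ_β(L) ≤ 4 δᶜ_β(L)` (`β ≥ 0`, `L ≥ 8`). -/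
theorem symDefect_le_four_mul_coldDefect (r : LatticeRep G) {β : ℝ} (hβ : 0 ≤ β) {L : ℕ} (hL : 8 ≤ L) :
    symDefect r.ρ β L ≤ 4 * coldDefect r.ρ β L :=
  symDefect_le_four_mul_boxDefect (tracePositive r hβ) hL

end Model

/-- **H½ — `HalfTimeBoundSC` (this line's NEW, load-bearing structural stub; crux, rank 3): bounded half-time excess of a pure symmetric
torus.**  For compact simple simply-connected `G` and every lattice representation `r` there are `A, β₁, L₁` such that for all `β ≥ β₁`
and `L ≥ L₁`: if the symmetric torus is `θ₀`-pure, `δ_β(L) ≤ θ₀` (17753's currency; SOME threshold `θ₀ > 0` — the weakest form the seam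
needs, typing checklist 4c(iv)), then `x_{L−2⌊L/4⌋,β}(L³) ≤ A`.
Why it might fail: a Hagedorn-type pile-up of levels between the energy scales `1/L` and `2/L` on pure tori (free energy at `T = 2/(La)`
exceeding every multiple of `T⁴`); nothing rigorous excludes it at weak coupling; the unconditional version is false-looking in the femto
regime (torons).  Expected TRUE for every compact G (Stefan–Boltzmann: `A ≈ exp(1.75 (N²−1) p/p_SB)`): NO confinement content.
Sources: Luscher1982 (femto universe / torons), BoydEtAl1996, BorsanyiEtAl2012 (`p ≤ p_SB` on the lattice), Hagedorn1965. -/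
def HalfTimeBoundSC : Prop :=
  ∀ (G : Type) [Group G] [TopologicalSpace G] [IsTopologicalGroup G] [CompactSpace G],
    IsCompactSimpleLieGroup G → SimplyConnectedSpace G →
    letI : MeasurableSpace G := borel G
    haveI : BorelSpace G := ⟨rfl⟩
    ∀ r : LatticeRep G, ∃ θ₀ : ℝ, 0 < θ₀ ∧ ∃ A β₁ : ℝ, ∃ L₁ : ℕ, ∀ β : ℝ, β₁ ≤ β → ∀ L : ℕ, L₁ ≤ L →
      symDefect r.ρ β L ≤ θ₀ → halfTimeExcess r.ρ β L ≤ A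

/-- **THE SEAM: E₁ ∧ H½ ⇒ E** (real proof).  `OneTorusExit` (item 17753, BY NAME) and `HalfTimeBoundSC` give `ColdPurityBridge.ColdExitSC`:
at the exit scale `L` (symmetric torus `ε₁`-pure) Cauchy–Schwarz puts `x_{L−⌊L/4⌋}(L³) ≤ √(2Aε₁)` and the sharp extension at aspect `3/4`
makes the cold box of side `4(L−⌊L/4⌋) ≥ L` `ε`-pure. -/
theorem coldExitSC_of_oneTorusExit_halfTime (hE₁ : OneTorusExit) (hH : HalfTimeBoundSC) : ColdExitSC := by
  intro G _ _ _ _ hG hsc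
  letI : MeasurableSpace G := borel G
  haveI : BorelSpace G := ⟨rfl⟩
  intro r ε hε
  obtain ⟨θ₀, hθ₀, A, β₂, L₁, hA⟩ := hH G hG hsc r
  set A' : ℝ := max A 1 with hA'
  have hA'1 : 1 ≤ A' := le_max_right _ _
  have hA'0 : 0 < A' := lt_of_lt_of_le one_pos hA'1
  -- target smallness `u := 2 √(2 A' ε₁)` with `2 (B₀ u) e^{B₀ u} ≤ ε`
  set η : ℝ := min 1 (ε / 6) with hη
  have hη0 : 0 < η := by positivity
  have hη1 : η ≤ 1 := min_le_left _ _
  have hηε : η ≤ ε / 6 := min_le_right _ _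
  set ε₁ : ℝ := min (min (1 / 8) θ₀) (η ^ 2 / (32 * A' * threeQuarterConst ^ 2)) with hε₁
  have hTQ : (0 : ℝ) < threeQuarterConst := by unfold threeQuarterConst; norm_num
  have hε₁0 : 0 < ε₁ := by positivity
  have hε₁a : ε₁ ≤ 1 / 8 := (min_le_left _ _).trans (min_le_left _ _)
  have hε₁θ : ε₁ ≤ θ₀ := (min_le_left _ _).trans (min_le_right _ _)
  have hε₁b : ε₁ ≤ η ^ 2 / (32 * A' * threeQuarterConst ^ 2) := min_le_right _ _
  obtain ⟨β₁, hβ₁⟩ := hE₁ G hG hsc r ε₁ hε₁0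
  refine ⟨max (max β₁ β₂) 0, fun β hβ L₀ => ?_⟩
  have hb1 : β₁ ≤ β := le_trans (le_trans (le_max_left _ _) (le_max_left _ _)) hβ
  have hb2 : β₂ ≤ β := le_trans (le_trans (le_max_right _ _) (le_max_left _ _)) hβ
  have hb0 : 0 ≤ β := le_trans (le_max_right _ _) hβ
  obtain ⟨L, hL, hδ⟩ := hβ₁ β hb1 (max (max L₀ L₁) 8)
  have hL0 : L₀ ≤ L := by omega
  have hL1 : L₁ ≤ L := by omega
  have hL8 : 8 ≤ L := by omega
  -- 17753's inline `Z` is `wilsonFinTorusPartition` by `rfl`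
  have hδ' : aspectDefect (wilsonFinTorusPartition r.ρ β) L L ≤ ε₁ := hδ
  have hAx : exc (wilsonFinTorusPartition r.ρ β L L L) (L - 2 * (L / 4)) ≤ A' :=
    le_trans (hA β hb2 L hL1 (le_trans hδ' hε₁θ)) (le_max_left _ _)
  have key := cold_of_symmetric_halfTime (axisSymmetric r β) (tracePositive r hb0) hL8 hAx hδ' (hε₁a.trans (by norm_num))
  refine ⟨4 * (L - L / 4), by omega, ?_⟩
  have h44 : 4 * (L - L / 4) / 4 = L - L / 4 := by omega
  rw [coldDefect_eq_aspectDefect, h44]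
  -- arithmetic: u ≤ η / B₀ hence 2 (B₀ u) e^{B₀ u} ≤ 2 η e ≤ 6 η ≤ ε
  set u : ℝ := 2 * Real.sqrt (2 * A' * ε₁) with hu
  have hu0 : 0 ≤ u := by positivity
  have hprod : 2 * A' * ε₁ ≤ (η / (2 * threeQuarterConst)) ^ 2 := by
    have h1 : 2 * A' * ε₁ ≤ 2 * A' * (η ^ 2 / (32 * A' * threeQuarterConst ^ 2)) :=
      mul_le_mul_of_nonneg_left hε₁b (by positivity)
    have h2 : 2 * A' * (η ^ 2 / (32 * A' * threeQuarterConst ^ 2)) = (η / (2 * threeQuarterConst)) ^ 2 / 4 := by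
      field_simp; ring
    have h3 : (η / (2 * threeQuarterConst)) ^ 2 / 4 ≤ (η / (2 * threeQuarterConst)) ^ 2 := by
      have : 0 ≤ (η / (2 * threeQuarterConst)) ^ 2 := by positivity
      linarith
    linarith
  have hsqrt : Real.sqrt (2 * A' * ε₁) ≤ η / (2 * threeQuarterConst) :=
    (Real.sqrt_le_sqrt hprod).trans (le_of_eq (Real.sqrt_sq (by positivity)))
  have hBu : threeQuarterConst * u ≤ η := by
    rw [hu]
    have := mul_le_mul_of_nonneg_left hsqrt (le_of_lt (mul_pos two_pos hTQ))
    calc threeQuarterConst * (2 * Real.sqrt (2 * A' * ε₁)) = 2 * threeQuarterConst * Real.sqrt (2 * A' * ε₁) := by ring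
      _ ≤ 2 * threeQuarterConst * (η / (2 * threeQuarterConst)) := this
      _ = η := by field_simp
  have hBu0 : 0 ≤ threeQuarterConst * u := by positivity
  have hexp : Real.exp (threeQuarterConst * u) ≤ 3 := by
    have h1 : Real.exp (threeQuarterConst * u) ≤ Real.exp 1 := Real.exp_le_exp.2 (hBu.trans hη1)
    have h2 := Real.exp_one_lt_d9
    linarith
  calc aspectDefect (wilsonFinTorusPartition r.ρ β) (4 * (L - L / 4)) (L - L / 4)
        ≤ 2 * (threeQuarterConst * u) * Real.exp (threeQuarterConst * u) := key
    _ ≤ 2 * η * 3 := by gcongr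
    _ ≤ ε := by linarith

/-! ## §4 Registered-shape stubs and the composition (the crux BY NAME; NOT registry-registered — RULING g9-№1 (2)) -/

/-- stub **E₁** — `DoublingDefect.OneTorusExit`, item stmt-QuantumFields-17753 BY NAME (crux rank 2 of the dormant route `DoublingDefect`;
the symmetric-torus one-scale exit; the weakest one-scale seed on the desk: `E ⇒ E₁` by `symDefect_le_four_mul_coldDefect`). -/
theorem stub_oneTorusExit : OneTorusExit := by
  sorry

/-- stub **H½** — `HalfTimeBoundSC`, the NEW structural input («no Hagedorn pile-up on pure tori»); LOAD-BEARING for the by-pass. -/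
theorem stub_halfTimeBound : HalfTimeBoundSC := by
  sorry

/-- stub **X** — the AF pin `ColdPressurePincer.AFToColdPressure`, BY NAME. -/
theorem stub_afPin : AFToColdPressure := by
  sorry

/-- stub **N** — the non-simply-connected residual `ColdPressurePincer.IRnsc`, BY NAME. -/
theorem stub_irNSC : IRnsc := by
  sorry

/-- The crux under a local reducible name (so that `IR_of_stubs` is the unique literal-crux theorem of the file). -/
abbrev CruxIR : Prop := Summit.QuantumFields.YangMills.Theses.BalabanLadder.IR

/-- **The dependency, sorry-free**: `E₁ → H½ → X → N → IR` = `IR_of_bridge R_holds (E₁ ∧ H½ ⇒ E) X N`. -/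
theorem IR_of_selfdualBridge (hE₁ : OneTorusExit) (hH : HalfTimeBoundSC) (hX : AFToColdPressure) (hN : IRnsc) : CruxIR :=
  IR_of_bridge R_holds (coldExitSC_of_oneTorusExit_halfTime hE₁ hH) hX hN

/-- **The line concludes the crux `BalabanLadder.IR` BY NAME** over the four stubs (E₁ by name = item 17753, H½ new, X, N by name). -/
theorem IR_of_stubs : Summit.QuantumFields.YangMills.Theses.BalabanLadder.IR :=
  IR_of_selfdualBridge stub_oneTorusExit stub_halfTimeBound stub_afPin stub_irNSC

end Summit.QuantumFields.YangMills.Cruxes.IR.SelfDualBridge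

end
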